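import Mathlib

/-!
# Route «KPlusLogSqLaw» — structure lemma for the `K = 4` fork: the AREA LAW for one-layer junctions

HONEST FRAMING.  Helper file toward the lifting cruxes of route `KPlusLogSqLaw`
(`Summit.ValiantsHypothesis.ValiantsHypothesis.Theses.KPlusLogSqLaw.WeakLifting`, ledger item
`stmt-ValiantsHypothesis-19561`, and the aside `…KPlusLogSqLaw.Lifting`, `stmt-ValiantsHypothesis-19772`; cell
`pub-symmetroid`, desk docket D2 «the K = 4 fork: is the tropical count T(m,4) quadratic or cubic in m?», seat
val-sym-lift-p3 g3, 2026-08-27).  It proves ONE ELEMENTARY COMBINATORIAL INEQUALITY and nothing else: no statement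
about `TropicalB`, `WeakLifting`, `Lifting`, `KPlusLogSqLaw`, `MatrixDescartes` or `VP ≠ VNP` is asserted or assumed,
and nothing here is a theorem about `T(m,4)`.

CONTEXT (memo HOME/val-sym-lift-p3/g3/K4-ARCHITECTURE.md, §3 (a)).  In a SUPPORT-FORCED tropical design (support
digraph acyclic off one hub column, so that the present terms are exactly the hub paths — lift-p3 g2, §2) the profile
value of a histogram is a maximum over paths of ADDITIVE arc profits.  A cubic `K = 4` family needs, by the rank-one
rigidity of the profile-value function, a strictly submodular coupling `J(i,j) ≈ −Λ·D·i·j + separable` between every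
pair of its three digits.  When such a coupling between a digit chain of length `P` and a digit chain of length `t` is
realised through ONE layer of junction nodes `c` — arcs `γ_i → z_c` with profit `p_c(i)` for `i` in a domain `dp c`,
arcs `z_c → a_j` with profit `q_c(j)` for `j ∈ dq c`, so that the realised coupling is `J(i,j) = max_c [p_c(i) + q_c(j)]`
— the present file shows that the junction costs at least `P·t` ARCS (= matrix entries):

* `card_mul_le_sum_card_of_submodularCover` — **AREA LAW** (with `snd_le_snd_of_tight`, `card_filter_tight_le`).  If `J : Fin P → Fin t → ℤ` is strictly submodular
  (`J i j + J i' j' < J i j' + J i' j` for `i < i'`, `j < j'`), every `p_c(i) + q_c(j)` on its domain is `≤ J i j`, and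
  every cell `(i,j)` is attained by some `c`, then `P * t ≤ ∑_c (|dp c| + |dq c|)`.
  PROOF: the cells where a fixed `c` is tight form a CHAIN of the product order (two incomparable tight cells
  `(i,j), (i',j')`, `i < i'`, `j > j'`, would give `J i j + J i' j' ≤ J i j' + J i' j`, against strict submodularity);
  a chain is injected into `dp c ⊔ dq c` by sending a cell to its column if its row contains an earlier tight cell and
  to its row otherwise; and the tight sets cover all `P·t` cells.
* `neg_mul_strictSubmodular` — the product coupling `J i j = −(L·i·j)` (`L > 0`) satisfies the hypothesis.

So ONE pairwise coupling of two digits of range `~m` is affordable (`~m²` entries — ARC-REGROWTH pays exactly this),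
which is the quantitative half of the memo's reading «sequential architectures are quadratic, not cubic»; the other
half (a scan cannot carry the third coupling) is a heuristic and is NOT formalised here.  The tangent identity
`−ij = max_c [(c·i − c²/4) + (−c·j − c²/4)]` shows that `O(P + t)` junction NODES suffice, so the law is genuinely about
arcs.  [this seat; elementary]
-/

-- `Summit.ValiantsHypothesis.ValiantsHypothesis.…` repeats a component by the D-0017 layout
-- (single-conjunct summit), which the `dupNamespace` linter flags; the name is mandated.
set_option linter.dupNamespace false
set_option autoImplicit false

namespace Summit.ValiantsHypothesis.ValiantsHypothesis.Theorems.LacunarySymmetroidMatrixDescartes.TropicalCensus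

open Finset

section AreaLaw

variable {P t : ℕ} {ι : Type*} [Fintype ι]

omit [Fintype ι] in
/-- **Tight cells are comparable.**  Under strict submodularity of `J` and the cover inequality `p_c(i) + q_c(j) ≤ J i j`
on the domain rectangle of `c`, two cells where `c` is tight are comparable in the product order: a smaller row forces a
column that is not larger. [this seat; elementary] -/
theorem snd_le_snd_of_tight (J : Fin P → Fin t → ℤ)
    (hJ : ∀ (i i' : Fin P) (j j' : Fin t), i < i' → j < j' → J i j + J i' j' < J i j' + J i' j)
    (p : ι → Fin P → ℤ) (q : ι → Fin t → ℤ) (dp : ι → Finset (Fin P)) (dq : ι → Finset (Fin t))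
    (hle : ∀ c, ∀ i ∈ dp c, ∀ j ∈ dq c, p c i + q c j ≤ J i j) (c : ι) {x y : Fin P × Fin t}
    (hx1 : x.1 ∈ dp c) (hx2 : x.2 ∈ dq c) (hxe : p c x.1 + q c x.2 = J x.1 x.2)
    (hy1 : y.1 ∈ dp c) (hy2 : y.2 ∈ dq c) (hye : p c y.1 + q c y.2 = J y.1 y.2)
    (hrow : x.1 < y.1) : x.2 ≤ y.2 := by
  by_contra h
  rw [not_le] at h
  -- cells x = (x.1, x.2) and y = (y.1, y.2) with x.1 < y.1 and y.2 < x.2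
  have h1 := hJ x.1 y.1 y.2 x.2 hrow h
  have h2 := hle c x.1 hx1 y.2 hy2
  have h3 := hle c y.1 hy1 x.2 hx2
  linarith

omit [Fintype ι] in
/-- **A tight set is no larger than its row domain plus its column domain.**  The cells of the domain rectangle
`dp c × dq c` where `p_c + q_c` attains `J` inject into `dp c ⊔ dq c`: send a cell to its column if its row contains a
tight cell with a smaller column, and to its row otherwise (injective because tight cells are pairwise comparable).
[this seat; elementary] -/
theorem card_filter_tight_le (J : Fin P → Fin t → ℤ)
    (hJ : ∀ (i i' : Fin P) (j j' : Fin t), i < i' → j < j' → J i j + J i' j' < J i j' + J i' j)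
    (p : ι → Fin P → ℤ) (q : ι → Fin t → ℤ) (dp : ι → Finset (Fin P)) (dq : ι → Finset (Fin t))
    (hle : ∀ c, ∀ i ∈ dp c, ∀ j ∈ dq c, p c i + q c j ≤ J i j) (c : ι) :
    ((dp c ×ˢ dq c).filter fun x => p c x.1 + q c x.2 = J x.1 x.2).card ≤ (dp c).card + (dq c).card := by
  classical
  set T := (dp c ×ˢ dq c).filter fun x => p c x.1 + q c x.2 = J x.1 x.2 with hT
  have hmem : ∀ {x : Fin P × Fin t}, x ∈ T → (x.1 ∈ dp c ∧ x.2 ∈ dq c) ∧ p c x.1 + q c x.2 = J x.1 x.2 := by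
    intro x hx
    rw [hT, mem_filter, mem_product] at hx
    exact hx
  -- comparability of tight cells, in the form used twice below
  have hchain : ∀ {x y : Fin P × Fin t}, x ∈ T → y ∈ T → x.1 < y.1 → x.2 ≤ y.2 := by
    intro x y hx hy hxy
    exact snd_le_snd_of_tight J hJ p q dp dq hle c (hmem hx).1.1 (hmem hx).1.2 (hmem hx).2
      (hmem hy).1.1 (hmem hy).1.2 (hmem hy).2 hxy
  have hmaps : Set.MapsTo (fun x : Fin P × Fin t =>
      if ∃ y ∈ T, y.1 = x.1 ∧ y.2 < x.2 then (Sum.inr x.2 : Fin P ⊕ Fin t) else Sum.inl x.1)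
      ↑T ↑((dp c).disjSum (dq c)) := by
    intro x hx
    have hx' := (hmem (Finset.mem_coe.mp hx)).1
    rw [Finset.mem_coe]
    dsimp only
    split_ifs
    · exact Finset.inr_mem_disjSum.mpr hx'.2
    · exact Finset.inl_mem_disjSum.mpr hx'.1
  have hinj : Set.InjOn (fun x : Fin P × Fin t =>
      if ∃ y ∈ T, y.1 = x.1 ∧ y.2 < x.2 then (Sum.inr x.2 : Fin P ⊕ Fin t) else Sum.inl x.1) ↑T := by
    intro x hx x' hx' hxx'
    rw [Finset.mem_coe] at hx hx'
    dsimp only at hxx'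
    by_cases h1 : ∃ y ∈ T, y.1 = x.1 ∧ y.2 < x.2 <;> by_cases h2 : ∃ y ∈ T, y.1 = x'.1 ∧ y.2 < x'.2
    · -- both columns: same column, both rows carry an earlier tight cell
      rw [if_pos h1, if_pos h2] at hxx'
      have hcol : x.2 = x'.2 := Sum.inr_injective hxx'
      obtain ⟨y, hy, hy1, hy2⟩ := h1
      obtain ⟨y', hy', hy'1, hy'2⟩ := h2
      rcases lt_trichotomy x.1 x'.1 with hr | hr | hr
      · -- x.1 < x'.1 = y'.1 : comparability of (x, y') forces x.2 ≤ y'.2 < x'.2 = x.2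
        have := hchain hx hy' (by rw [hy'1]; exact hr)
        exact absurd (lt_of_le_of_lt this hy'2) (by rw [hcol]; exact lt_irrefl _)
      · exact Prod.ext hr hcol
      · have := hchain hx' hy (by rw [hy1]; exact hr)
        exact absurd (lt_of_le_of_lt this hy2) (by rw [← hcol]; exact lt_irrefl _)
    · rw [if_pos h1, if_neg h2] at hxx'
      exact absurd hxx' Sum.inr_ne_inl
    · rw [if_neg h1, if_pos h2] at hxx'
      exact absurd hxx' Sum.inl_ne_inr
    · -- both rows: same row, both row-minimal ⇒ same column
      rw [if_neg h1, if_neg h2] at hxx'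
      have hrow : x.1 = x'.1 := Sum.inl_injective hxx'
      rcases lt_trichotomy x.2 x'.2 with hc | hc | hc
      · exact absurd ⟨x, hx, hrow, hc⟩ h2
      · exact Prod.ext hrow hc
      · exact absurd ⟨x', hx', hrow.symm, hc⟩ h1
  calc T.card ≤ ((dp c).disjSum (dq c)).card := Finset.card_le_card_of_injOn _ hmaps hinj
    _ = (dp c).card + (dq c).card := Finset.card_disjSum _ _

/-- **AREA LAW for one-layer junctions.**  Let `J : Fin P → Fin t → ℤ` be strictly submodular, and let finitely many
junction nodes `c` carry left profits `p c` on a row domain `dp c` and right profits `q c` on a column domain `dq c`, with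
`p c i + q c j ≤ J i j` on the domain rectangle of every `c` and every cell attained by some `c` (i.e. `J = max_c (p_c ⊕ q_c)`
as a max-plus rank-one cover).  Then the total number of junction arcs is at least the area: `P·t ≤ ∑_c (|dp c| + |dq c|)`.
[this seat; elementary] -/
theorem card_mul_le_sum_card_of_submodularCover (J : Fin P → Fin t → ℤ)
    (hJ : ∀ (i i' : Fin P) (j j' : Fin t), i < i' → j < j' → J i j + J i' j' < J i j' + J i' j)
    (p : ι → Fin P → ℤ) (q : ι → Fin t → ℤ) (dp : ι → Finset (Fin P)) (dq : ι → Finset (Fin t))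
    (hle : ∀ c, ∀ i ∈ dp c, ∀ j ∈ dq c, p c i + q c j ≤ J i j)
    (hcov : ∀ i j, ∃ c, i ∈ dp c ∧ j ∈ dq c ∧ p c i + q c j = J i j) :
    P * t ≤ ∑ c, ((dp c).card + (dq c).card) := by
  classical
  have hsub : (univ : Finset (Fin P × Fin t)) ⊆
      (univ : Finset ι).biUnion (fun c => (dp c ×ˢ dq c).filter fun x => p c x.1 + q c x.2 = J x.1 x.2) := by
    intro x _
    rw [mem_biUnion]
    obtain ⟨c, hi, hj, heq⟩ := hcov x.1 x.2
    exact ⟨c, mem_univ c, mem_filter.mpr ⟨mem_product.mpr ⟨hi, hj⟩, heq⟩⟩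
  calc P * t = (univ : Finset (Fin P × Fin t)).card := by
          rw [card_univ, Fintype.card_prod, Fintype.card_fin, Fintype.card_fin]
    _ ≤ ((univ : Finset ι).biUnion
          (fun c => (dp c ×ˢ dq c).filter fun x => p c x.1 + q c x.2 = J x.1 x.2)).card := card_le_card hsub
    _ ≤ ∑ c, ((dp c ×ˢ dq c).filter fun x => p c x.1 + q c x.2 = J x.1 x.2).card := card_biUnion_le
    _ ≤ ∑ c, ((dp c).card + (dq c).card) :=
          sum_le_sum fun c _ => card_filter_tight_le J hJ p q dp dq hle c

/-- The product coupling `J i j = −(L·i·j)` with `L > 0` (the `−Λ·D·n₁·n₂` interaction demanded of a cubic family by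
the rank-one rigidity of the profile-value function) is strictly submodular in the sense of the area law. [elementary] -/
theorem neg_mul_strictSubmodular (L : ℤ) (hL : 0 < L) (i i' : Fin P) (j j' : Fin t) (hi : i < i') (hj : j < j') :
    -(L * i * j) + -(L * i' * j') < -(L * i * j') + -(L * i' * (j : ℤ)) := by
  have h1 : ((i : ℕ) : ℤ) < ((i' : ℕ) : ℤ) := by exact_mod_cast hi
  have h2 : ((j : ℕ) : ℤ) < ((j' : ℕ) : ℤ) := by exact_mod_cast hj
  nlinarith [mul_pos (sub_pos.mpr h1) (sub_pos.mpr h2)]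

/-! ### Nodes are cheap, arcs are not: the tangent identity

The complementary half of the area law's reading: the product coupling `−2·i·j` IS a one-layer max-plus rank-one
cover with only `O(P + t)` junction NODES `c` (the integers between `−t` and `P`), namely
`−2ij = max_c [(2ci − c² − i²) + (−2cj − j²)]`, the maximum being attained exactly at `c = i − j` (tangent lines of
the parabola `(i − j)²`).  So the `P·t` lower bound of `card_mul_le_sum_card_of_submodularCover` is a statement about
ARCS (matrix entries), not about the number of junction nodes. -/

/-- the tangent identity behind `−2ij = max_c [(2ci − c² − i²) + (−2cj − j²)]`: every tangent term falls short of
`−2ij` by the square `(c − (i − j))²`. [elementary] -/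
theorem tangent_term_eq (i j c : ℤ) :
    (2 * c * i - c ^ 2 - i ^ 2) + (-(2 * c * j) - j ^ 2) = -(2 * i * j) - (c - (i - j)) ^ 2 := by
  ring

/-- every tangent term is at most `−2ij` … -/
theorem tangent_term_le (i j c : ℤ) :
    (2 * c * i - c ^ 2 - i ^ 2) + (-(2 * c * j) - j ^ 2) ≤ -(2 * i * j) := by
  rw [tangent_term_eq]
  nlinarith [sq_nonneg (c - (i - j))]

/-- … with equality exactly at the node `c = i − j`. -/
theorem tangent_term_eq_iff (i j c : ℤ) :
    (2 * c * i - c ^ 2 - i ^ 2) + (-(2 * c * j) - j ^ 2) = -(2 * i * j) ↔ c = i - j := by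
  rw [tangent_term_eq]
  constructor
  · intro h
    have h0 : (c - (i - j)) ^ 2 = 0 := by linarith
    exact sub_eq_zero.mp (pow_eq_zero_iff (two_ne_zero) |>.mp h0)
  · intro h
    rw [h, sub_self, zero_pow two_ne_zero, sub_zero]

/-- **`O(P + t)` junction nodes realise the product coupling.**  For `i < P`, `j < t` the node `c = i − j` lies in the
window `(−t, P)`, so the `P + t − 1` nodes of that window cover every cell: `−2ij` is attained by some node and never
exceeded (`tangent_term_le`). [elementary] -/
theorem exists_tangent_node (i : Fin P) (j : Fin t) :
    ∃ c : ℤ, -(t : ℤ) < c ∧ c < P ∧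
      (2 * c * i - c ^ 2 - (i : ℤ) ^ 2) + (-(2 * c * j) - (j : ℤ) ^ 2) = -(2 * (i : ℤ) * j) := by
  refine ⟨(i : ℤ) - j, ?_, ?_, (tangent_term_eq_iff _ _ _).mpr rfl⟩
  · have hi : (0 : ℤ) ≤ (i : ℕ) := by exact_mod_cast Nat.zero_le _
    have hj : ((j : ℕ) : ℤ) < t := by exact_mod_cast j.isLt
    linarith
  · have hi : ((i : ℕ) : ℤ) < P := by exact_mod_cast i.isLt
    have hj : (0 : ℤ) ≤ (j : ℕ) := by exact_mod_cast Nat.zero_le _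
    linarith

end AreaLaw

end Summit.ValiantsHypothesis.ValiantsHypothesis.Theorems.LacunarySymmetroidMatrixDescartes.TropicalCensus
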